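import Summits.BirchSwinnertonDyer.BirchSwinnertonDyer.Theorems.TameQuarticSolventSolventPairLowerBoundSolventField
import Mathlib.NumberTheory.NumberField.InfinitePlace.TotallyRealComplex
import HarnessLib

/-!
# Route `TameQuarticSolvent`, crux `SolventPairLowerBound` (stmt-BirchSwinnertonDyer-21391), line `birth` —
# glue «SolventField», part 2: the solvent quartic `L″ = ℚ(√d)(√β)` is TOTALLY REAL for `d > 0` and `β`
# totally positive (e.g. `β = d + √d`)

HONEST FRAMING. Theorems only; helper file (`--supports stmt-BirchSwinnertonDyer-21391`), companion of
`TameQuarticSolventSolventPairLowerBoundSolventField.lean`. The route's exact-`BSD₃` input (card K1) lives over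
a TOTALLY REAL tame quartic; this file supplies that property for the fields of the companion file, in
Mathlib's currency `NumberField.IsTotallyReal`, from square-root generators: `K = ℚ + ℚθ₁`, `θ₁² = d ≥ 0`
⇒ every `ψ : K →+* ℂ` is real; `M = K + Kθ`, `θ² = β` with `σ(β) > 0` at every real `σ` ⇒ every
`φ : M →+* ℂ` is real; and `β = d + θ₁` is totally positive once `d > 1`. Elementary; nothing here is
progress on the open stubs, and BSD is not proved by any of this. No route file is imported.
-/

-- D-0017: single-problem summit, so `Summit.BirchSwinnertonDyer.BirchSwinnertonDyer.…` repeats a namespace BY DESIGN.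
set_option linter.dupNamespace false

noncomputable section

open scoped NumberField ComplexConjugate

open NumberField Literature.NumberTheory.QuadraticFields

namespace Summit.BirchSwinnertonDyer.BirchSwinnertonDyer.Theorems.SolventPairLowerBound

/-! ## Total reality of `K = ℚ(√d)` (`d > 0`) and of `M = K(√β)` (`β` totally positive) -/

section TotallyReal

/-- A complex number whose square is a non-negative real is real. [folklore] -/
theorem conj_eq_self_of_sq_eq_ofReal {z : ℂ} {r : ℝ} (hr : 0 ≤ r) (hz : z ^ 2 = (r : ℂ)) :
    conj z = z := by
  rw [Complex.conj_eq_iff_im]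
  have him : (z ^ 2).im = 0 := by rw [hz, Complex.ofReal_im]
  have hre : (z ^ 2).re = r := by rw [hz, Complex.ofReal_re]
  rw [sq, Complex.mul_im] at him
  rw [sq, Complex.mul_re] at hre
  by_contra h
  have hre0 : z.re = 0 := by
    have : z.re * z.im = 0 := by linarith
    rcases mul_eq_zero.mp this with h0 | h0
    · exact h0
    · exact absurd h0 h
  rw [hre0, zero_mul, zero_sub] at hre
  have : z.im * z.im ≤ 0 := by linarith
  exact h (mul_self_eq_zero.mp (le_antisymm this (mul_self_nonneg _)))

variable {K M : Type} [Field K] [NumberField K] [Field M] [NumberField M] [Algebra K M]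

/-- **`ℚ(√d)` with `d ≥ 0` is totally real, embedding by embedding**: for `[K : ℚ] = 2`, `θ₁² = d`,
`θ₁ ∉ ℚ`, `0 ≤ d`, every `ψ : K →+* ℂ` is real (`ψ(θ₁)² = d ≥ 0`, and `K = ℚ + ℚ θ₁`). [folklore] -/
theorem conj_apply_eq_of_sq_eq_intCast (h2 : Module.finrank ℚ K = 2) {d : ℤ} (hd : 0 ≤ d) {θ₁ : K}
    (hθ₁ : θ₁ ^ 2 = (d : K)) (hθK : θ₁ ∉ Set.range (algebraMap ℚ K)) (ψ : K →+* ℂ) (x : K) :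
    conj (ψ x) = ψ x := by
  have hθ : conj (ψ θ₁) = ψ θ₁ := by
    refine conj_eq_self_of_sq_eq_ofReal (r := (d : ℝ)) (by exact_mod_cast hd) ?_
    rw [← map_pow, hθ₁, map_intCast]; norm_cast
  obtain ⟨a, b, rfl⟩ := Quadratic.exists_eq_add_mul h2 hθK x
  simp only [map_add, map_mul, hθ]
  have ha : ∀ q : ℚ, conj (ψ (algebraMap ℚ K q)) = ψ (algebraMap ℚ K q) := fun q ↦ by
    rw [show algebraMap ℚ K q = (q : K) from rfl, map_ratCast, Complex.conj_eq_iff_im]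
    exact Complex.ratCast_im q
  rw [ha, ha]

/-- `ℚ(√d)` with `d ≥ 0` is a totally real number field. [folklore] -/
theorem isTotallyReal_of_sq_eq_intCast (h2 : Module.finrank ℚ K = 2) {d : ℤ} (hd : 0 ≤ d)
    {θ₁ : K} (hθ₁ : θ₁ ^ 2 = (d : K)) (hθK : θ₁ ∉ Set.range (algebraMap ℚ K)) :
    IsTotallyReal K := by
  refine ⟨fun w ↦ InfinitePlace.isReal_iff.mpr (ComplexEmbedding.isReal_iff.mpr ?_)⟩
  ext x
  rw [ComplexEmbedding.conjugate_coe_eq]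
  exact conj_apply_eq_of_sq_eq_intCast h2 hd hθ₁ hθK _ x

/-- **`M = K(√β)` is totally real when `K = ℚ(√d)`, `d ≥ 0`, and `β` is totally positive**: for
`φ : M →+* ℂ`, `φ|_K` is real, `φ(θ)² = φ(β) > 0`, and `M = K + K θ`. [folklore] -/
theorem conj_apply_eq_of_sq_eq_of_totallyPositive (h2 : Module.finrank ℚ K = 2) {d : ℤ}
    (hd : 0 ≤ d) {θ₁ : K} (hθ₁ : θ₁ ^ 2 = (d : K)) (hθK : θ₁ ∉ Set.range (algebraMap ℚ K))
    (h2' : Module.finrank K M = 2) {β : K} {θ : M} (hθ : θ ^ 2 = algebraMap K M β)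
    (hθM : θ ∉ Set.range (algebraMap K M)) (hβ : ∀ σ : K →+* ℝ, 0 < σ β)
    (φ : M →+* ℂ) (x : M) : conj (φ x) = φ x := by
  set ψ : K →+* ℂ := φ.comp (algebraMap K M) with hψ
  have hψreal : ComplexEmbedding.IsReal ψ := by
    refine ComplexEmbedding.isReal_iff.mpr ?_
    ext k
    rw [ComplexEmbedding.conjugate_coe_eq]
    exact conj_apply_eq_of_sq_eq_intCast h2 hd hθ₁ hθK ψ k
  have hψK : ∀ k : K, conj (φ (algebraMap K M k)) = φ (algebraMap K M k) := fun k ↦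
    conj_apply_eq_of_sq_eq_intCast h2 hd hθ₁ hθK ψ k
  have hθr : conj (φ θ) = φ θ := by
    refine conj_eq_self_of_sq_eq_ofReal (r := hψreal.embedding β) (hβ _).le ?_
    rw [← map_pow, hθ, ComplexEmbedding.IsReal.coe_embedding_apply]
    rfl
  obtain ⟨a, b, rfl⟩ := Quadratic.exists_eq_add_mul h2' hθM x
  simp only [map_add, map_mul, hθr, hψK]

/-- `M = K(√β)` (`K = ℚ(√d)`, `d ≥ 0`, `β` totally positive) is a totally real number field — the
"totally real tame quartic" of route `TameQuarticSolvent`. [folklore] -/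
theorem isTotallyReal_of_sq_eq_of_totallyPositive (h2 : Module.finrank ℚ K = 2) {d : ℤ}
    (hd : 0 ≤ d) {θ₁ : K} (hθ₁ : θ₁ ^ 2 = (d : K)) (hθK : θ₁ ∉ Set.range (algebraMap ℚ K))
    (h2' : Module.finrank K M = 2) {β : K} {θ : M} (hθ : θ ^ 2 = algebraMap K M β)
    (hθM : θ ∉ Set.range (algebraMap K M)) (hβ : ∀ σ : K →+* ℝ, 0 < σ β) :
    IsTotallyReal M := by
  refine ⟨fun w ↦ InfinitePlace.isReal_iff.mpr (ComplexEmbedding.isReal_iff.mpr ?_)⟩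
  ext x
  rw [ComplexEmbedding.conjugate_coe_eq]
  exact conj_apply_eq_of_sq_eq_of_totallyPositive h2 hd hθ₁ hθK h2' hθ hθM hβ _ x

/-- **`β = d + √d` is totally positive for `d > 1`**: under a real embedding `σ`, `σ(θ₁) = ±√d` and
`d ± √d > 0`. [folklore] -/
theorem embedding_intCast_add_pos {d : ℤ} (hd : 1 < d) {θ₁ : K} (hθ₁ : θ₁ ^ 2 = (d : K))
    (σ : K →+* ℝ) : 0 < σ ((d : K) + θ₁) := by
  have hsq : σ θ₁ ^ 2 = (d : ℝ) := by rw [← map_pow, hθ₁, map_intCast]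
  have hd' : (1 : ℝ) < d := by exact_mod_cast hd
  rw [map_add, map_intCast]
  nlinarith [sq_nonneg (σ θ₁ + 1), sq_nonneg (σ θ₁ - 1)]

/-- **The side conditions of K2a on `β` are jointly satisfiable**: for `[K : ℚ] = 2`, `θ₁² = d`, `ord₃ d = 1`,
`1 < d`, the element `β = d + θ₁` has odd valuation (`= exp(−1)`) at every place of `K` above `3` and is
totally positive — so the class of `β`'s over which the twisted upper bound `stub_kolyvaginTwistedUpperOverK`
(skeleton v4 of crux `SolventPairLowerBound`) quantifies is non-empty, and `M = K(√β)` is a totally real quartic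
with `e(w|3) = 4` (`valuation_intCast_add_eq`, `embedding_intCast_add_pos`). [folklore] -/
theorem exists_beta_oddValuation_totallyPositive (h2 : Module.finrank ℚ K = 2) {d : ℤ} (hd1 : 1 < d)
    (hd : padicValInt 3 d = 1) {θ₁ : K} (hθ₁ : θ₁ ^ 2 = (d : K)) :
    ∃ β : K,
      (∀ v : IsDedekindDomain.HeightOneSpectrum (𝓞 K), ((3 : ℕ) : 𝓞 K) ∈ v.asIdeal →
        ∃ k : ℤ, v.valuation K β = WithZero.exp (2 * k + 1)) ∧
      (∀ σ : K →+* ℝ, 0 < σ β) := by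
  haveI : Fact (Nat.Prime 3) := ⟨Nat.prime_three⟩
  exact ⟨(d : K) + θ₁, fun v hv ↦ ⟨-1, valuation_intCast_add_eq 3 h2 hθ₁ hd v hv⟩,
    embedding_intCast_add_pos hd1 hθ₁⟩

end TotallyReal

end Summit.BirchSwinnertonDyer.BirchSwinnertonDyer.Theorems.SolventPairLowerBound

end
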